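import Summits.QuantumFields.YangMills.Theorems.BalabanUVNodesK0RecordFormatNamesAx

/-!
# K0⁷ — THE RECORD-SIDE FORMAT NAMES, EDITION 12: the DECAY-ONLY, REAL-COUPLING Π-receipts (box form and SAME-RUN letter form),
# generic over a term family (§19) and at the record (bare §18 and block-axial [Ax-4]) — the currency «T-3′» of director-ym №471

Cell `ym-nodeO-ideate`, DEFINER seat `ym-nodeO-def-1` (gen 34); director-ym №471 (5) («names: `recordPlim[Ax]` ∕ `PlimDecayOnRunsOf` … append-only»)
on lens seat `ymgap-nodeO-lens-1` g4's located finding «THE SCHEME BIT» (HOME `nodeO-cover/LENS-1-NODE-v2.md` §3 I-5 + kernel companion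
`LENS-1-PiDecayRuns-v1.lean` 3c15041c4b73908f ∕ v1.1): the Π-HOLOMORPHIC receipts (`PiHoloAtOf ∕ PiHoloUniformOf`, §19; `RecordPiHoloAt[Ax] ∕
RecordPiHoloUniform[Ax]`) transcribe [I]'s «(or analytic)» ALTERNATIVE (p.266 L33–37), whereas every 2′∕2″ consumer reads only (5.10)-DECAY of the REAL
limit kernel at the history's OWN last coupling.  THIS LEAF names that weaker, print-side currency — the DEFINITIONS of lens-1's companion §1∕§1b∕§2∕§2b
re-homed VERBATIM (bodies byte-for-byte, credit above) under the names namespace so that port texts (typer-1's T-3′ `PortPiDecayUniformH`), the K-restate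
(plan g98) and the lens lines cite ONE tree name each.  `--kind definition --supports stmt-QuantumFields-20541 --as helper`; count-neutral.
[I] = [Balaban1987RG1].

WHAT THIS FILE IS (definitions only; statement-form; every receipt is a HYPOTHESIS-shaped `Prop` with parameters and ASSERTS NOTHING):
* GENERIC over `fam : TermFamily1 F 𝔄`, `ρ`, `bV` (§1): `PlimDecayOnBoxOf` — ONE `(C, δ₁)`, `δ₁ > 0`, (5.10) for the `(0,1)`-component of the LIMIT kernel
  `plimOf F fam ρ bV k v` at every box history `v ∈ ]0, γ]^{k+1}`; `PlimDecayOnRunsOf β γ₀ C δ₁` — the SAME-RUN letter form of №467 (iii)∕№468 («∀ n gs,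
  RGEqH n β gs → Step.InInterval γ₀ n gs → ∀ k ≤ n, BODY(k; prefixOf gs k)»); the FINITE-VOLUME currency `PvolDecayEvOnBoxOf ∕ PvolDecayEvOnRunsOf`
  (POINTWISE-EVENTUAL in the volume `K` — what `B12Decay510.decay510_of_leaves` delivers per volume through an eventually-isometric window; NOT the
  «uniform in K on windowed kernels» reading, which the periodicity mechanism voids) and the (1.21) letters `PolLimitOnBoxOf ∕ PolLimitOnRunsOf`.
* RECORD (§2), bare and Ax: `RecordPlimDecayOnRuns[Ax] F a₀ ε₂₉ γ₀ C δ₁` (runs driven by the record's OWN β `betaOfRecord₁₃[Ax] F 2 (thetaFill F a₀ ε₂₉)`,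
  kernel `recordPlim[Ax]`), `RecordPvolDecayEvOnRuns[Ax]`, `RecordPolLimitOnRuns[Ax]`.
The implications (holomorphic ⟹ box ⟹ runs; finite volume + (1.21) ⟹ limit; runs ⟹ the RUN |β| letter `|β_{k+1}(prefixOf gs k)| ≤ β′₅.₁₀`, also at
stub 2′'s θ-witness) are lemma file 5 (`…K0RecordFormatNamesLemmas5`, proof kind).  Lens-1's DOOR (§3: decay on runs along cofinal radii ⟹ `K0CompCofinalRadii`
⟹ K0⁷ by name) and NON-VACUITY test (§4) are the LINE's content and stay with the lens ∕ its lead.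

RULING OF RECORD (CRIT-1 g33 Q-8 «SCHEME BIT», nodeO STATUS 2026-08-31T00:29:13Z, UPHELD; director-ym №471 (5) honesty sentence): «the Π-holomorphic
(complex-coupling) currency is print's unexecuted alternative (p.266); record-facing texts read real-coupling decay only» — the slot-8 text of record is
T-3′ `PortPiDecayUniformH` (decay (5.10) at ONE real history); §19's `PiHoloAtOf ∕ PiHoloUniformOf` and `RecordPiHoloAt[Ax] ∕ RecordPiHoloUniform[Ax]` stay
as OFFERED generic receipts of the alternative (they imply these, lemma file 5).

HONEST FRAMING.  Definitions only; NOTHING of Bałaban is asserted, ported or discharged; 27930⁸-Ax ∕ 27931⁷′ ∕ 26648 v4Ax SIGNED·RENDERED·OPEN (route rev 30),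
slot 8 not yet born; stub 2′ OPEN; K0⁷ `Record13SepCoPHInhabited` NOT closed and, AS VETTED, choice-centred;
NODE O not inhabited (0∕1); COUNT 8∕28 · K 1∕4 UNMOVED; finite `𝕋⁴_{L^K}` at fixed ε — NOT continuum ∕ ℝ⁴ ∕ OS; **the Yang–Mills mass gap (Clay) is NOT
proved by any of this.**  No `sorry`, `instance`, `notation`; standard axioms.
-/

noncomputable section

open scoped BigOperators Matrix.Norms.L2Operator Topology
open Set Filter

namespace Summit.QuantumFields.YangMills.Theorems.K0RecordFormatNames

open Literature.MathematicalPhysics.QuantumFieldTheory.Balaban1983to89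
open Literature.MathematicalPhysics.QuantumFieldTheory.Balaban1983to89.Node00
open Literature.MathematicalPhysics.QuantumFieldTheory.Balaban1983to89.T4Continuum (T4Family)
open Literature.MathematicalPhysics.QuantumFieldTheory.Balaban1983to89.FlowStep

variable (F : T4Family)

/-! ## §1  GENERIC decay-only receipts over a term family (limit kernel; finite volume; the (1.21) letter) -/

section Generic

variable {𝔄 : Type*} [NormedRing 𝔄] [NormedAlgebra ℝ 𝔄]
variable {V : Type*} [NormedAddCommGroup V] [NormedSpace ℝ V] {ι : Type*} [Fintype ι]
variable (fam : TermFamily1 F 𝔄) (ρ : V →L[ℝ] 𝔄) (bV : Module.Basis ι ℝ V)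

/-- **RECEIPT «(5.10) ON THE BOX» for a term family, decay-only**: ONE pair `(C, δ₁)`, `δ₁ > 0`, such that for every step `k` and every history
`v ∈ ]0, γ]^{k+1}` the `(0, 1)`-component of the LIMIT kernel `plimOf F fam ρ bV k v` obeys (5.10).  No holomorphy, no complex coupling, no `t`-variable.
(Lens-1 g4 companion §1, verbatim.) [cite: Balaban1987RG1, (5.10) p.293, (1.21) p.264, p.263 («absolute constants»)] -/
def PlimDecayOnBoxOf (γ C δ₁ : ℝ) : Prop :=
  0 < δ₁ ∧ ∀ (k : ℕ) (v : Fin (k + 1) → ℝ), v ∈ Box γ k → B12Sec2to5.Decay510 (plimOf F fam ρ bV k v 0 1) C δ₁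

/-- **RECEIPT «(5.10) ALONG RUNS» for a term family, decay-only, SAME-RUN letter form**: along every in-interval solution `gs` of (0.20) driven by `β` up to
`n`, for every `k ≤ n`, the LIMIT kernel at the run's own prefix obeys (5.10) with ONE `(C, δ₁)`. [cite: Balaban1987RG1, (0.20) p.256, (5.10) p.293, (1.21) p.264] -/
def PlimDecayOnRunsOf (β : HBeta) (γ₀ C δ₁ : ℝ) : Prop :=
  0 < δ₁ ∧ ∀ (n : ℕ) (gs : ℕ → ℝ), RGEqH n β gs → Step.InInterval γ₀ n gs →
    ∀ k, k ≤ n → B12Sec2to5.Decay510 (plimOf F fam ρ bV k (prefixOf gs k) 0 1) C δ₁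

/-- **RECEIPT «(5.10) PER VOLUME, POINTWISE-EVENTUALLY IN THE VOLUME, ON THE BOX» for a term family** (real couplings; the finite-volume kernels
`pvolOf … K`; for each `z ∈ ℤ⁴` the bound holds for all large `K` — the reading `B12Decay510.decay510_of_leaves` delivers per volume through an
eventually-isometric window, NOT «uniform for all K and z» on the windowed periodic kernels). [cite: Balaban1987RG1, (4.37) p.291, (5.10) p.293, (1.21) p.264] -/
def PvolDecayEvOnBoxOf (γ C δ₁ : ℝ) : Prop :=
  0 < δ₁ ∧ ∀ (k : ℕ) (v : Fin (k + 1) → ℝ), v ∈ Box γ k →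
    ∀ z : Fin 4 → ℤ, ∀ᶠ K in atTop, |pvolOf F fam ρ bV k v K 0 1 z| ≤ C * Real.exp (-δ₁ * B12Sec2to5.l1 z)

/-- **The (1.21) letter ON THE BOX for a term family** (the volume limit of the finite-volume kernels exists at every box history; print: «This limit
exists by the localized representation (1.7)»). [cite: Balaban1987RG1, (1.21) p.264] -/
def PolLimitOnBoxOf (γ : ℝ) : Prop :=
  ∀ (k : ℕ) (v : Fin (k + 1) → ℝ), v ∈ Box γ k → PolLimitExists F (k + 1) (fun K => fam k v K) ρ bV

/-- **RECEIPT «(5.10) PER VOLUME, POINTWISE-EVENTUALLY, ALONG RUNS»** (SAME-RUN letter form). [cite: Balaban1987RG1, (0.20) p.256, (4.37) p.291, (5.10) p.293] -/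
def PvolDecayEvOnRunsOf (β : HBeta) (γ₀ C δ₁ : ℝ) : Prop :=
  0 < δ₁ ∧ ∀ (n : ℕ) (gs : ℕ → ℝ), RGEqH n β gs → Step.InInterval γ₀ n gs → ∀ k, k ≤ n →
    ∀ z : Fin 4 → ℤ, ∀ᶠ K in atTop, |pvolOf F fam ρ bV k (prefixOf gs k) K 0 1 z| ≤ C * Real.exp (-δ₁ * B12Sec2to5.l1 z)

/-- **The (1.21) letter ALONG RUNS for a term family.** [cite: Balaban1987RG1, (1.21) p.264, (0.20) p.256] -/
def PolLimitOnRunsOf (β : HBeta) (γ₀ : ℝ) : Prop :=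
  ∀ (n : ℕ) (gs : ℕ → ℝ), RGEqH n β gs → Step.InInterval γ₀ n gs → ∀ k, k ≤ n →
    PolLimitExists F (k + 1) (fun K => fam k (prefixOf gs k) K) ρ bV

end Generic

/-! ## §2  RECORD instances: bare (`recordPlim ∕ recordPvol`, runs driven by `betaOfRecord₁₃ (thetaFill …)`) and block-axial (`recordPlimAx ∕ recordPvolAx`,
`betaOfRecord₁₃Ax (thetaFill …)`) -/

variable (a₀ ε₂₉ : ℝ)

/-- **RECEIPT «(5.10) ALONG RUNS AT THE RECORD» (bare names), decay-only, SAME-RUN letter form**: along every in-interval solution of (0.20) driven by the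
record's OWN β `betaOfRecord₁₃ F 2 (thetaFill F a₀ ε₂₉)` up to `n`, for every `k ≤ n`, the record's LIMIT kernel `recordPlim F a₀ ε₂₉ k (prefixOf gs k)`
(component `(0, 1)`, a kernel on `ℤ⁴`) obeys (5.10) with ONE `(C, δ₁)`, `δ₁ > 0`.  Real couplings only; read at the history's own last coupling (no `t`, no
endpoint, no `Pc`); names THE record's kernel (not junk-inhabitable by `0`). [cite: Balaban1987RG1, (0.20) p.256, (1.21)–(1.22) p.264, (5.10) p.293] -/
def RecordPlimDecayOnRuns (γ₀ C δ₁ : ℝ) : Prop :=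
  0 < δ₁ ∧ ∀ (n : ℕ) (gs : ℕ → ℝ), RGEqH n (betaOfRecord₁₃ F 2 (thetaFill F a₀ ε₂₉)) gs → Step.InInterval γ₀ n gs →
    ∀ k, k ≤ n → B12Sec2to5.Decay510 (recordPlim F a₀ ε₂₉ k (prefixOf gs k) 0 1) C δ₁

/-- **… block-axial twin** over `recordPlimAx` and the RE-CENTRED β `betaOfRecord₁₃Ax F 2 (thetaFill F a₀ ε₂₉)` ([Ax-4] names).
[cite: Balaban1987RG1, (0.20) p.256, (1.21)–(1.22) p.264, (5.10) p.293] -/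
def RecordPlimDecayOnRunsAx (γ₀ C δ₁ : ℝ) : Prop :=
  0 < δ₁ ∧ ∀ (n : ℕ) (gs : ℕ → ℝ), RGEqH n (betaOfRecord₁₃Ax F 2 (thetaFill F a₀ ε₂₉)) gs → Step.InInterval γ₀ n gs →
    ∀ k, k ≤ n → B12Sec2to5.Decay510 (recordPlimAx F a₀ ε₂₉ k (prefixOf gs k) 0 1) C δ₁

/-- **RECEIPT «(5.10) PER VOLUME, POINTWISE-EVENTUALLY, ALONG RUNS, AT THE RECORD» (bare)**: the finite-volume kernels `recordPvol … K` at the run's own prefix —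
the shape a port text proved at ONE REAL coupling per volume delivers. [cite: Balaban1987RG1, (0.20) p.256, (4.37) p.291, (5.10) p.293] -/
def RecordPvolDecayEvOnRuns (γ₀ C δ₁ : ℝ) : Prop :=
  0 < δ₁ ∧ ∀ (n : ℕ) (gs : ℕ → ℝ), RGEqH n (betaOfRecord₁₃ F 2 (thetaFill F a₀ ε₂₉)) gs → Step.InInterval γ₀ n gs → ∀ k, k ≤ n →
    ∀ z : Fin 4 → ℤ, ∀ᶠ K in atTop, |recordPvol F a₀ ε₂₉ k (prefixOf gs k) K 0 1 z| ≤ C * Real.exp (-δ₁ * B12Sec2to5.l1 z)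

/-- **The (1.21) letter of record ALONG RUNS** (bare): the volume limit exists at every prefix of every in-interval solution (the letter of record
`PolLimitsExistOfRecord₁₃` is its Window-indexed form). [cite: Balaban1987RG1, (1.21) p.264, (0.20) p.256] -/
def RecordPolLimitOnRuns (γ₀ : ℝ) : Prop :=
  ∀ (n : ℕ) (gs : ℕ → ℝ), RGEqH n (betaOfRecord₁₃ F 2 (thetaFill F a₀ ε₂₉)) gs → Step.InInterval γ₀ n gs → ∀ k, k ≤ n →
    (letI θ := thetaFill F a₀ ε₂₉
     letI := θ.instVβ₁; letI := θ.instVβ₂; letI := θ.instιβ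
     PolLimitExists F (k + 1) (fun K => recordTerms F a₀ ε₂₉ k (prefixOf gs k) K) θ.ρ8 θ.bV)

/-- **… Ax twin** of the finite-volume receipt (`recordPvolAx`, runs driven by `betaOfRecord₁₃Ax (thetaFill …)`). [cite: Balaban1987RG1, (0.20) p.256, (4.37) p.291, (5.10) p.293] -/
def RecordPvolDecayEvOnRunsAx (γ₀ C δ₁ : ℝ) : Prop :=
  0 < δ₁ ∧ ∀ (n : ℕ) (gs : ℕ → ℝ), RGEqH n (betaOfRecord₁₃Ax F 2 (thetaFill F a₀ ε₂₉)) gs → Step.InInterval γ₀ n gs → ∀ k, k ≤ n →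
    ∀ z : Fin 4 → ℤ, ∀ᶠ K in atTop, |recordPvolAx F a₀ ε₂₉ k (prefixOf gs k) K 0 1 z| ≤ C * Real.exp (-δ₁ * B12Sec2to5.l1 z)

/-- **… Ax twin** of the (1.21) letter along runs (`recordTermsAx`). [cite: Balaban1987RG1, (1.21) p.264, (0.20) p.256] -/
def RecordPolLimitOnRunsAx (γ₀ : ℝ) : Prop :=
  ∀ (n : ℕ) (gs : ℕ → ℝ), RGEqH n (betaOfRecord₁₃Ax F 2 (thetaFill F a₀ ε₂₉)) gs → Step.InInterval γ₀ n gs → ∀ k, k ≤ n →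
    (letI θ := thetaFill F a₀ ε₂₉
     letI := θ.instVβ₁; letI := θ.instVβ₂; letI := θ.instιβ
     PolLimitExists F (k + 1) (fun K => recordTermsAx F a₀ ε₂₉ k (prefixOf gs k) K) θ.ρ8 θ.bV)

end Summit.QuantumFields.YangMills.Theorems.K0RecordFormatNames

end
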